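import Summits.BirchSwinnertonDyer.Rank1Residual.X11b.KolyvaginH44OfTraceRelation
import Summits.BirchSwinnertonDyer.Rank1Residual.X11b.KolyvaginRingClassCyclic
import Literature.NumberTheory.EllipticCurves.RingClassFieldAbelian
import HarnessLib

/-!
# The abstract Euler data of the `h44` programme EXIST for the concrete ring class tower —
# level-by-level data for `KolyvaginH44.h44_concrete_of_traceRelation_of_congruence`

Cell `b2b-bsdres`, team x11b3 (N8/O2), `h44` programme; lead GEN 9 deal R10-34 (concrete-currency
glue), prequel of `X11b/KolyvaginH44Concrete`.  Summit-side THEOREM-ONLY file (no definition, no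
named fact, no `sorry`); `K : Type`.  HONEST FRAMING: plumbing to concrete currency — the abstract
level-by-level Euler data and Galois dictionary over which the END of the `h44` programme
(`KolyvaginH44.h44_of_prop37_of_dvd`, `h44_of_traceRelation_of_congruence_of_dvd`) and the H37
bridge (`KolyvaginH37Bridge.h37_of_traceRelation_of_congruence`) quantify are SUPPLIED, for every
level `m : ℕ`, from the concrete ring class tower `K[m] ⊂ ℂ` and (at the divisors of one top level
`n`) from coherent concrete Kolyvagin–Heegner data; `h37` / `h44` / (γ) NOT discharged; nothing
`p = 3`-specific; nothing booked; no mark / label / count.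

## What is proved (`K` imaginary quadratic unless stated, `ι : K → ℂ`)

* `exists_eq_algebraMap_of_mem_ringClassField_zero` — the corner `m = 0`: `K[0] = ι(K)` (there is
  no reduced form of discriminant `0`), so every element of `K[0]` is `ι k`; hence
  `eq_one_of_mem_ringClassGal_zero` (`𝒢_0 = 1`).
* `isMulCommutative_ringClassGal'`, `finite_ringClassGal` — `𝒢_m = Gal(K[m]/K)` is commutative
  (lit2 `isMulCommutative_ringClassGal` for `m ≠ 0`) and finite, for EVERY `m`.
* `exists_absGaloisRestrict` — for every `m` and every `K`-embedding `e : K[m] → K̄` there is a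
  homomorphism `π : Γ_K → 𝒢_m` with `τ • e x = e (π τ x)` (restriction to the normal subextension
  `e(K[m])`, Mathlib `AlgEquiv.restrictNormalHom`; at `m = 0`, `π = 1`) — the Galois dictionary
  `hπρ` of the END with `ρ_m` the inclusion `𝒢_m ≤ Aut_ℚ(K[m])`.
* `KolyvaginHeegnerData.toGeomPoints_pointGalHom` — `E(K[m]) → E(K̄)` (along `d.emb`) carries the
  coordinatewise action of `γ ∈ Aut(K[m])` to that of any `τ ∈ Γ_K` restricting to `γ` (the END's
  `hj`).
* `KolyvaginHeegnerData.exists_section_of_transversal` — a section `f` of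
  `𝒢_m → 𝒢_m ⧸ Gal(K[m]/K[1])` with values in the transversal `d.S` (Gross (4.1): *"Let `S` be a set
  of coset representatives for `G_n` in `𝒢_n`"*; the END's `hfsec`, the bridge's `hfS`).
* `KolyvaginHeegnerData.σ_pow_succ_eq_one` — `σ_q ^ (q+1) = 1` at a square-free level with inert
  prime factors (the END's `hord`; tree `pow_succ_eq_one_of_mem_ringClassGalOver`).
* **`exists_levelData`** — for a square-free Kolyvagin top level `n` and Kolyvagin–Heegner data
  `d m` at its divisors: at EVERY `m : ℕ` there are `σ_m`, `H_m`, `f_m`, `y_m`, `π_m`, `j_m`, `e_m`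
  over `𝒢_m = ringClassGal ι m ↷ E(K[m])` satisfying the END's structural hypotheses (`hord`, `hj`,
  `hπρ`, `hfsec`, `hHρ`) and, at `m ∣ n`, the bridge's dictionary to `d m` (`j_m = toGeomPoints`,
  `y_m = y(m)`, `σ_m = σ`, `f_m ∈ S`, …); off the divisors `j_m = 0` (junk level).

## References
* [GrossLMS1991] B. H. Gross, *Kolyvagin's work on modular elliptic curves*, LMS LNS 153 (1991), §3
  (p. 216–217: `𝒢_n`, `G_n`, `G_ℓ`, `σ_ℓ`), §4 (4.1).
* [Cox2013] D. A. Cox, *Primes of the form x² + ny²*, §2.A (reduced forms), §9.A, Thm. 11.1.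
-/

noncomputable section

open scoped Classical
open WeierstrassCurve Field NumberField IsDedekindDomain Finset
open Literature.NumberTheory.EllipticCurves Literature.NumberTheory.GaloisRepresentations
open Literature.NumberTheory.EllipticCurves.KolyvaginCocycle
open Literature.NumberTheory.EllipticCurves.KolyvaginEuler
open Literature.NumberTheory.EllipticCurves.RingClassField
open Literature.NumberTheory.EllipticCurves.ModularForms
open Literature.NumberTheory.QuadraticFields.BinaryQuadraticForm

namespace Summit.BirchSwinnertonDyer.Rank1Residual.X11b.KolyvaginH44

-- `K : Type`: the tree's ring-class class field theory is universe `0`.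
variable {K : Type} [Field K] [NumberField K]

/-! ## §1 The corner `m = 0`: `K[0] = ι(K)` and `𝒢_0 = 1` -/

/-- **`K[0] = ι(K)`**: there is no reduced form of discriminant `0² · d_K = 0` (the enumeration of
`reducedForms 0` runs over `1 ≤ a ≤ 0`), so `K[0]` is generated by `ι(K)` alone and every element of
`K[0]` is `ι k`. [folklore] -/
theorem exists_eq_algebraMap_of_mem_ringClassField_zero (ι : K →+* ℂ)
    (x : ringClassField K ι 0) : ∃ k : K, x = algebraMap K (ringClassField K ι 0) k := by
  have h0 : reducedForms 0 = ∅ := by simp [reducedForms, coeffBound]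
  have hK0 : ringClassField K ι 0 ≤ ι.fieldRange := by
    rw [ringClassField, Subfield.closure_le, ringClassSingularModuli]
    rintro z (⟨k, rfl⟩ | hz)
    · exact ⟨k, rfl⟩
    · exfalso
      rw [Finset.mem_coe] at hz
      simp [h0] at hz
  obtain ⟨k, hk⟩ := hK0 x.2
  exact ⟨k, Subtype.ext (by rw [coe_algebraMap_ringClassField]; exact hk.symm)⟩

/-- **`𝒢_0 = 1`**: an automorphism of `K[0] = ι(K)` fixing `ι(K)` pointwise is the identity.
[folklore] -/
theorem eq_one_of_mem_ringClassGal_zero (ι : K →+* ℂ)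
    {γ : ringClassField K ι 0 ≃ₐ[ℚ] ringClassField K ι 0} (hγ : γ ∈ ringClassGal ι 0) : γ = 1 := by
  refine AlgEquiv.ext fun x ↦ ?_
  obtain ⟨k, rfl⟩ := exists_eq_algebraMap_of_mem_ringClassField_zero ι x
  rw [AlgEquiv.one_apply]
  exact smul_algebraMap_of_mem_ringClassGal hγ k

/-! ## §2 `𝒢_m` is commutative and finite, at every level -/

/-- **`𝒢_m = Gal(K[m]/K)` is commutative for every `m`** (Gross 1991, §3; lit2
`isMulCommutative_ringClassGal` for `m ≠ 0`, `𝒢_0 = 1` at `m = 0`).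
[cite: GrossLMS1991, §3 (𝒢_n = Gal(K_n/K))] [cite: Cox2013, §9.A (pp. 180–181)] -/
theorem isMulCommutative_ringClassGal' (hK : IsImaginaryQuadratic K) (ι : K →+* ℂ) (m : ℕ) :
    IsMulCommutative (ringClassGal ι m) := by
  by_cases hm : m = 0
  · subst hm
    refine ⟨⟨fun a b ↦ ?_⟩⟩
    have ha : a = 1 := Subtype.ext (eq_one_of_mem_ringClassGal_zero ι a.2)
    have hb : b = 1 := Subtype.ext (eq_one_of_mem_ringClassGal_zero ι b.2)
    rw [ha, hb]
  · exact isMulCommutative_ringClassGal hK ι hm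

/-- **`𝒢_m` is finite for every `m`** (`K[m]/K` is a finite Galois extension for `m ≠ 0`, tree
`finiteDimensional_and_isGalois_ringClassField`; `𝒢_0 = 1`). [folklore] -/
theorem finite_ringClassGal (hK : IsImaginaryQuadratic K) (ι : K →+* ℂ) (m : ℕ) :
    Finite (ringClassGal ι m) := by
  by_cases hm : m = 0
  · subst hm
    haveI : Subsingleton (ringClassGal ι 0) :=
      ⟨fun a b ↦ Subtype.ext ((eq_one_of_mem_ringClassGal_zero ι a.2).trans
        (eq_one_of_mem_ringClassGal_zero ι b.2).symm)⟩
    infer_instance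
  · haveI := (finiteDimensional_and_isGalois_ringClassField hK ι hm).1
    haveI : FiniteDimensional ℚ (ringClassField K ι m) :=
      Module.Finite.trans K (ringClassField K ι m)
    infer_instance

/-! ## §3 Restriction of `Γ_K` to `𝒢_m` along a `K`-embedding `K[m] → K̄` -/

/-- **The Galois dictionary `hπρ`**: for every level `m` and every `K`-embedding `e : K[m] → K̄`
there is a homomorphism `π : Γ_K → 𝒢_m = Gal(K[m]/K)` through which `Γ_K` acts on `e(K[m])`:
`τ • e x = e (π τ x)` — for `m ≠ 0` the restriction to the normal subextension `K[m]/K`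
(Mathlib `AlgEquiv.restrictNormalHom`, restriction of scalars to `ℚ`), for `m = 0` (`K[0] = ι(K)`)
the trivial homomorphism. Gross 1991, §4: *"`𝒢_n` be the Galois group of `K_n` over `K`"*.
[cite: GrossLMS1991, §4 (𝒢_n)] -/
theorem exists_absGaloisRestrict (hK : IsImaginaryQuadratic K) (ι : K →+* ℂ) (m : ℕ)
    (e : ringClassField K ι m →ₐ[K] AlgebraicClosure K) :
    ∃ π : absoluteGaloisGroup K →* ringClassGal ι m,
      ∀ (τ : absoluteGaloisGroup K) (x : ringClassField K ι m),
        τ • e x = e ((π τ : ringClassField K ι m ≃ₐ[ℚ] ringClassField K ι m) x) := by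
  by_cases hm : m = 0
  · refine ⟨1, fun τ x ↦ ?_⟩
    obtain ⟨k, hk⟩ : ∃ k : K, x = algebraMap K (ringClassField K ι m) k := by
      subst hm; exact exists_eq_algebraMap_of_mem_ringClassField_zero ι x
    rw [hk, MonoidHom.one_apply, OneMemClass.coe_one, AlgEquiv.one_apply, AlgHom.commutes]
    exact AlgEquiv.commutes (absoluteGaloisGroup.toAlgEquiv K τ) k
  haveI := (finiteDimensional_and_isGalois_ringClassField hK ι hm).1
  haveI := (finiteDimensional_and_isGalois_ringClassField hK ι hm).2
  letI : Algebra (ringClassField K ι m) (AlgebraicClosure K) := e.toRingHom.toAlgebra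
  haveI : IsScalarTower K (ringClassField K ι m) (AlgebraicClosure K) :=
    IsScalarTower.of_algebraMap_eq fun k ↦ (e.commutes k).symm
  have halg : ∀ x : ringClassField K ι m, algebraMap (ringClassField K ι m) (AlgebraicClosure K) x =
      e x := fun _ ↦ rfl
  -- restriction of scalars `Aut_K(K[m]) → 𝒢_m ≤ Aut_ℚ(K[m])`
  have hσℚ : ∀ (σ : ringClassField K ι m ≃ₐ[K] ringClassField K ι m) (r : ℚ),
      σ (algebraMap ℚ (ringClassField K ι m) r) = algebraMap ℚ (ringClassField K ι m) r :=
    fun σ r ↦ by rw [eq_ratCast (algebraMap ℚ (ringClassField K ι m)) r, map_ratCast]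
  let ρ₀ : (ringClassField K ι m ≃ₐ[K] ringClassField K ι m) → ringClassGal ι m := fun σ ↦
    ⟨{ σ with commutes' := hσℚ σ }, by
      refine (_root_.mem_fixingSubgroup_iff _).mpr ?_
      rintro x ⟨k, hk⟩
      have hx : x = algebraMap K (ringClassField K ι m) k :=
        Subtype.ext (by rw [coe_algebraMap_ringClassField, hk])
      rw [hx]
      exact σ.commutes k⟩
  have hρ₀ : ∀ σ x, (ρ₀ σ : ringClassField K ι m ≃ₐ[ℚ] ringClassField K ι m) x = σ x :=
    fun _ _ ↦ rfl
  let ρ : (ringClassField K ι m ≃ₐ[K] ringClassField K ι m) →* ringClassGal ι m :=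
    { toFun := ρ₀
      map_one' := by apply Subtype.ext; ext x; rw [hρ₀]; rfl
      map_mul' := fun a b ↦ by apply Subtype.ext; ext x; rw [hρ₀]; rfl }
  have hρ : ∀ σ x, (ρ σ : ringClassField K ι m ≃ₐ[ℚ] ringClassField K ι m) x = σ x := fun _ _ ↦ rfl
  refine ⟨ρ.comp ((AlgEquiv.restrictNormalHom (ringClassField K ι m)).comp
    (absoluteGaloisGroup.toAlgEquiv K).toMonoidHom), fun τ x ↦ ?_⟩
  rw [MonoidHom.comp_apply, MonoidHom.comp_apply, hρ, ← halg, ← halg]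
  exact (AlgEquiv.restrictNormal_commutes (absoluteGaloisGroup.toAlgEquiv K τ)
    (ringClassField K ι m) x).symm

/-! ## §4 Equivariance of `E(K[m]) → E(K̄)` -/

section Data

variable {N : ℕ} [NeZero N] {W : WeierstrassCurve ℚ} {Dt : ModularParametrizationData W N} {β : ℤ}
  {ι : K →+* ℂ} {m : ℕ}

/-- **`hj` for the concrete tower**: if `τ ∈ Γ_K` restricts along `d.emb` to `γ ∈ Aut(K[m])`
(`τ • d.emb x = d.emb (γ x)`), then `d.toGeomPoints (γ • P) = τ • d.toGeomPoints P` for every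
`P ∈ E(K[m])` — both actions are coordinatewise (`pointGalHom`, `Affine.Point.map`). [folklore] -/
theorem _root_.Literature.NumberTheory.EllipticCurves.KolyvaginHeegnerData.toGeomPoints_pointGalHom
    (d : KolyvaginHeegnerData Dt β ι m) {τ : absoluteGaloisGroup K}
    {γ : ringClassField K ι m ≃ₐ[ℚ] ringClassField K ι m}
    (h : ∀ x : ringClassField K ι m, τ • d.emb x = d.emb (γ x))
    (P : (W.baseChange (ringClassField K ι m)).toAffine.Point) :
    d.toGeomPoints (pointGalHom W (ringClassField K ι m) γ P) = τ • d.toGeomPoints P := by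
  rcases P with _ | ⟨x, y, hxy⟩
  · show d.toGeomPoints (pointGalHom W (ringClassField K ι m) γ 0) = τ • d.toGeomPoints 0
    rw [map_zero, map_zero, smul_zero]
  · -- the point `γ • P` and its image
    have hγxy : (W.baseChange (ringClassField K ι m)).toAffine.Nonsingular (γ x) (γ y) :=
      (Affine.baseChange_nonsingular W (γ : ringClassField K ι m →ₐ[ℚ] ringClassField K ι m).injective
        x y).mpr hxy
    have hns : ((W.baseChange K).baseChange (AlgebraicClosure K)).toAffine.Nonsingular
        (d.emb x) (d.emb y) :=
      (Affine.baseChange_nonsingular W d.emb.toRatAlgHom.injective x y).mpr hxy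
    have hns' : ((W.baseChange K).baseChange (AlgebraicClosure K)).toAffine.Nonsingular
        (d.emb (γ x)) (d.emb (γ y)) :=
      (Affine.baseChange_nonsingular W d.emb.toRatAlgHom.injective (γ x) (γ y)).mpr hγxy
    have lhs : d.toGeomPoints (pointGalHom W (ringClassField K ι m) γ (.some x y hxy)) =
        Affine.Point.some (d.emb (γ x)) (d.emb (γ y)) hns' := by
      rw [pointGalHom_apply, Affine.Point.map_some]
      show Affine.Point.map (W' := W) d.emb.toRatAlgHom (.some (γ x) (γ y) _) = _
      rw [Affine.Point.map_some]
      rfl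
    have rhs : τ • d.toGeomPoints (.some x y hxy) =
        Affine.Point.some (d.emb (γ x)) (d.emb (γ y)) hns' := by
      have h1 : d.toGeomPoints (.some x y hxy) =
          Affine.Point.map (W' := W) d.emb.toRatAlgHom (.some x y hxy) := rfl
      rw [h1, Affine.Point.map_some]
      change Affine.Point.map (W' := W.baseChange K)
          ((absoluteGaloisGroup.toAlgEquiv K τ : AlgebraicClosure K ≃ₐ[K] AlgebraicClosure K) :
            AlgebraicClosure K →ₐ[K] AlgebraicClosure K)
          (Affine.Point.some (d.emb x) (d.emb y) hns) = _
      rw [Affine.Point.map_some]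
      simp only [Affine.Point.some.injEq, AlgEquiv.coe_toAlgHom]
      exact ⟨h x, h y⟩
    rw [lhs, rhs]

/-! ## §5 The section over the transversal `S`, and `σ_q ^ (q+1) = 1` -/

/-- **A section of `𝒢_m → 𝒢_m ⧸ G_m` with values in `S`** (`G_m = Gal(K[m]/K[1])` pulled back to
`𝒢_m`; Gross 1991, (4.1): *"Let `S` be a set of coset representatives for `G_n` in `𝒢_n`"* = the
field `KolyvaginHeegnerData.S_transversal`): the END's `hfsec` and the bridge's `hfS` for the
concrete data. [cite: GrossLMS1991, §4 (4.1)] -/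
theorem _root_.Literature.NumberTheory.EllipticCurves.KolyvaginHeegnerData.exists_section_of_transversal
    (d : KolyvaginHeegnerData Dt β ι m) :
    ∃ f : ringClassGal ι m ⧸ (ringClassGalOver ι m 1).comap (ringClassGal ι m).subtype →
        ringClassGal ι m,
      (∀ c, (f c : ringClassGal ι m ⧸ (ringClassGalOver ι m 1).comap (ringClassGal ι m).subtype) = c) ∧
      ∀ c, (f c : ringClassField K ι m ≃ₐ[ℚ] ringClassField K ι m) ∈ d.S := by
  set H := (ringClassGalOver ι m 1).comap (ringClassGal ι m).subtype with hH
  have hex : ∀ c : ringClassGal ι m ⧸ H, ∃ s : ringClassGal ι m,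
      (s : ringClassGal ι m ⧸ H) = c ∧ (s : ringClassField K ι m ≃ₐ[ℚ] ringClassField K ι m) ∈ d.S := by
    intro c
    obtain ⟨g, rfl⟩ := QuotientGroup.mk_surjective c
    obtain ⟨s, ⟨hsS, hgs⟩, -⟩ := d.S_transversal g g.2
    refine ⟨⟨s, d.S_subset s hsS⟩, ?_, hsS⟩
    rw [eq_comm, QuotientGroup.eq, hH, Subgroup.mem_comap]
    simpa using hgs
  choose f hf hfS using hex
  exact ⟨f, hf, hfS⟩

/-- **`σ_q ^ (q+1) = 1`** for the datum's generator `σ_q` of `G_q = Gal(K[m]/K[m/q])` at a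
square-free level `m` whose prime factor `q` is inert in `K` (Gross 1991, §3: *"`G_ℓ` … cyclic of
order `ℓ + 1`"*; tree `pow_succ_eq_one_of_mem_ringClassGalOver`) — the END's `hord` for the concrete
data. [cite: GrossLMS1991, §3 (chunk 217 L1)] -/
theorem _root_.Literature.NumberTheory.EllipticCurves.KolyvaginHeegnerData.σ_pow_succ_eq_one
    (hK : IsImaginaryQuadratic K) (d : KolyvaginHeegnerData Dt β ι m) (hm : Squarefree m) {q : ℕ}
    (hq : q ∈ m.primeFactors) (hinert : (Ideal.span {(q : 𝓞 K)}).IsPrime) :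
    d.σ q ^ (q + 1) = 1 := by
  have hm0 : m ≠ 0 := Squarefree.ne_zero hm
  obtain ⟨hqp, hqm, -⟩ := Nat.mem_primeFactors.mp hq
  have hqm' : ¬ q ∣ m / q := by
    intro h
    have : q * q ∣ m := by
      have := Nat.mul_dvd_mul_left q h
      rwa [Nat.mul_div_cancel' hqm] at this
    exact hqp.one_lt.ne' (Nat.isUnit_iff.mp (hm q this))
  exact RingClassTower.pow_succ_eq_one_of_mem_ringClassGalOver hK ι hm0 hqp hqm hqm' hinert
    ((d.zpowers_σ q hq) ▸ Subgroup.mem_zpowers (d.σ q))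

/-! ## §6 A `K`-embedding `K[m] → K̄` exists at every level -/

/-- **A `K`-embedding `K[m] → K̄` exists for every `m`** (`K[m]/K` is algebraic: finite for
`m ≠ 0`, and `K[0] = ι(K)`). [folklore] -/
theorem nonempty_algHom_ringClassField (hK : IsImaginaryQuadratic K) (ι : K →+* ℂ) (m : ℕ) :
    Nonempty (ringClassField K ι m →ₐ[K] AlgebraicClosure K) := by
  haveI : Algebra.IsAlgebraic K (ringClassField K ι m) := by
    by_cases hm : m = 0
    · subst hm
      refine ⟨fun x ↦ ?_⟩
      obtain ⟨k, rfl⟩ := exists_eq_algebraMap_of_mem_ringClassField_zero ι x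
      exact isAlgebraic_algebraMap k
    · haveI := (finiteDimensional_and_isGalois_ringClassField hK ι hm).1
      infer_instance
  exact ⟨IsAlgClosed.lift⟩

/-! ## §7 Level data for the END of the `h44` programme, at every level -/

/-- **Level data at every `m : ℕ`.**  For `K` imaginary quadratic, a square-free top level `n`
whose prime factors are inert in `K`, and Kolyvagin–Heegner data `d m` at every `m ∣ n`: at EVERY
level `m` there are generators `σ_m : ℕ → 𝒢_m`, the subgroup `H_m` (= `Gal(K[m]/K[1])` pulled back
to `𝒢_m = ringClassGal ι m`), a section `f_m` of `𝒢_m → 𝒢_m ⧸ H_m`, a point `y_m ∈ E(K[m])`, a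
restriction `π_m : Γ_K → 𝒢_m`, an additive `j_m : E(K[m]) → E(K̄)` and a `K`-embedding
`e_m : K[m] → K̄` with: `σ_m q ^ (q+1) = 1` on the prime factors (`hord`); `j_m (π_m τ • P) =
τ • j_m P` (`hj`, coordinatewise actions); `τ • e_m x = e_m (π_m τ x)` (`hπρ`); `f_m` a section
(`hfsec`) and `H_m ≤ Gal(K[m]/K[1])` (`hHρ`); AT THE DIVISORS `m ∣ n` the dictionary to `d m`:
`j_m = toGeomPoints`, `y_m = y(m)`, `σ_m q = σ_q` on the prime factors, `f_m` valued in the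
transversal `S` (Gross (4.1)); OFF the divisors `j_m = 0` (a junk level, never read by the END's
conclusion).  These are the abstract Euler data over which `KolyvaginH44.h44_of_prop37_of_dvd` and
`KolyvaginH37Bridge.h37_of_traceRelation_of_congruence` quantify, SUPPLIED. [cite: GrossLMS1991, §3
(p. 216–217), §4 (4.1)] -/
theorem exists_levelData (hK : IsImaginaryQuadratic K) (ι : K →+* ℂ) {n : ℕ} (hn : Squarefree n)
    (hinert : ∀ q ∈ n.primeFactors, (Ideal.span {(q : 𝓞 K)}).IsPrime)
    (d : (m : ℕ) → m ∣ n → KolyvaginHeegnerData Dt β ι m) (m : ℕ) :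
    ∃ (σ : ℕ → ringClassGal ι m) (H : Subgroup (ringClassGal ι m))
      (f : ringClassGal ι m ⧸ H → ringClassGal ι m)
      (y : (W.baseChange (ringClassField K ι m)).toAffine.Point)
      (π : absoluteGaloisGroup K →* ringClassGal ι m)
      (j : (W.baseChange (ringClassField K ι m)).toAffine.Point →+ geomPoints (W.baseChange K))
      (e : ringClassField K ι m →ₐ[K] AlgebraicClosure K),
      (∀ q ∈ m.primeFactors, σ q ^ (q + 1) = 1) ∧
      (∀ (τ : absoluteGaloisGroup K) (P : (W.baseChange (ringClassField K ι m)).toAffine.Point),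
        j (pointGalHom W (ringClassField K ι m)
          (π τ : ringClassField K ι m ≃ₐ[ℚ] ringClassField K ι m) P) = τ • j P) ∧
      (∀ (τ : absoluteGaloisGroup K) (x : ringClassField K ι m),
        τ • e x = e ((π τ : ringClassField K ι m ≃ₐ[ℚ] ringClassField K ι m) x)) ∧
      (∀ c, (f c : ringClassGal ι m ⧸ H) = c) ∧
      (∀ h ∈ H, (h : ringClassField K ι m ≃ₐ[ℚ] ringClassField K ι m) ∈ ringClassGalOver ι m 1) ∧
      (∀ hm : m ∣ n,
        j = (d m hm).toGeomPoints ∧ y = (d m hm).y ∧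
        (∀ q ∈ m.primeFactors,
          (σ q : ringClassField K ι m ≃ₐ[ℚ] ringClassField K ι m) = (d m hm).σ q) ∧
        (∀ c, (f c : ringClassField K ι m ≃ₐ[ℚ] ringClassField K ι m) ∈ (d m hm).S)) ∧
      (¬ m ∣ n → j = 0) := by
  have hn0 : n ≠ 0 := Squarefree.ne_zero hn
  by_cases hm : m ∣ n
  · -- a genuine level: the data of `d m`
    set dm := d m hm with hdm
    let e : ringClassField K ι m →ₐ[K] AlgebraicClosure K :=
      { dm.emb with commutes' := dm.emb_apply }
    have he : ∀ x, e x = dm.emb x := fun _ ↦ rfl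
    obtain ⟨π, hπ⟩ := exists_absGaloisRestrict hK ι m e
    obtain ⟨f, hf, hfS⟩ := dm.exists_section_of_transversal
    have hσmem : ∀ q ∈ m.primeFactors, dm.σ q ∈ ringClassGal ι m := fun q hq ↦
      ringClassGalOver_le_ringClassGal ι m (m / q) ((dm.zpowers_σ q hq) ▸ Subgroup.mem_zpowers _)
    let σ : ℕ → ringClassGal ι m := fun q ↦
      if hq : q ∈ m.primeFactors then ⟨dm.σ q, hσmem q hq⟩ else 1
    have hσ : ∀ q ∈ m.primeFactors,
        (σ q : ringClassField K ι m ≃ₐ[ℚ] ringClassField K ι m) = dm.σ q := fun q hq ↦ by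
      simp only [σ, dif_pos hq]
    refine ⟨σ, _, f, dm.y, π, dm.toGeomPoints, e, ?_, ?_, hπ, hf, ?_, fun hm' ↦ ?_,
      fun h ↦ (h hm).elim⟩
    · intro q hq
      apply Subtype.ext
      rw [SubmonoidClass.coe_pow, hσ q hq, OneMemClass.coe_one]
      exact dm.σ_pow_succ_eq_one hK (hn.squarefree_of_dvd hm) hq
        (hinert q (Nat.primeFactors_mono hm hn0 hq))
    · intro τ P
      exact dm.toGeomPoints_pointGalHom (fun x ↦ by rw [← he, ← he]; exact hπ τ x) P
    · intro h hh
      exact Subgroup.mem_comap.mp hh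
    · have hdd : d m hm' = dm := rfl
      rw [hdd]
      exact ⟨rfl, rfl, hσ, hfS⟩
  · -- a junk level
    obtain ⟨e⟩ := nonempty_algHom_ringClassField hK ι m
    obtain ⟨π, hπ⟩ := exists_absGaloisRestrict hK ι m e
    refine ⟨fun _ ↦ 1, (ringClassGalOver ι m 1).comap (ringClassGal ι m).subtype,
      fun c ↦ c.out, 0, π, 0, e, fun _ _ ↦ one_pow _, fun τ P ↦ ?_, hπ,
      fun c ↦ QuotientGroup.out_eq' c, fun h hh ↦ Subgroup.mem_comap.mp hh,
      fun hm' ↦ (hm hm').elim, fun _ ↦ rfl⟩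
    rw [AddMonoidHom.zero_apply, AddMonoidHom.zero_apply, smul_zero]

end Data

end Summit.BirchSwinnertonDyer.Rank1Residual.X11b.KolyvaginH44

end
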